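import Summits.AtomisticToContinuum.Crystallization.Theorems.ChargedEnergyGapLineMomentA
import HarnessLib

/-!
# ChargedEnergyGap · NODE 82 «LineMoment» (lens-3 g81) — file B of three: frame lemmas (§L5: lattice steps, poles, injectivity of the lattice map,
the identification of NODE 81's frame-free descriptors `octMinDepth` / `octMaxKink` / `capVal` with the hole calculus of the lattice depth —
`lm_octMinDepth_eq`, `lm_octMaxKink_eq`, `lm_capVal_eq`, PROVED) and the two line constraints of the lattice depth function (§L6: `1`-Lipschitz at
spacing `ρ` and the discrete semiconcavity `d(w + e)² + d(w − e)² ≤ 2 d(w)² + 2ρ²` from the tree lemma `infDist_sq_secondDiff_le`, PROVED)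

Thesis, census, tags and the «why novel» sentence: module docstring of `…Theorems.ChargedEnergyGapLineMoment` (file C).  Imports ONLY
`…Theorems.ChargedEnergyGapLineMomentA` and `HarnessLib`; no `set_option`, no `sorry`, no instance, no notation, no `private`; namespace
`…Theorems.ChargedEnergyGapChartDial`; all statements formal bookkeeping for the glue of file C.
-/

noncomputable section

open scoped Classical
open Literature.MathematicalPhysics.StatisticalMechanics Literature.Geometry.DiscreteGeometry
open Summit.AtomisticToContinuum.Crystallization.Theses.PricedLinkCensus
open Summit.AtomisticToContinuum.Crystallization.Theorems.ChargedEnergyGapNegative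

namespace Summit.AtomisticToContinuum.Crystallization.Theorems.ChargedEnergyGapChartDial

/-! ## §L5 Frame lemmas: lattice steps, poles, and the identification of the frame-free descriptors with the hole calculus (PROVED) -/

section FrameLemmas

/-- A lattice step: `cubicPt (w + n • e_a) = cubicPt w + (n ρ) • f_a`. [formal bookkeeping] -/
theorem lm_cubicPt_add_zsmul (c₀ : E3) (f : Fin 3 → E3) (ρ : ℝ) (w : Fin 3 → ℤ) (n : ℤ) (a : Fin 3) :
    cubicPt c₀ f ρ (w + n • axisZ a) = cubicPt c₀ f ρ w + ((n : ℝ) * ρ) • f a := by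
  unfold cubicPt
  have h : ∀ i : Fin 3, (((w + n • axisZ a) i : ℤ) : ℝ) * ρ = (w i : ℝ) * ρ + (if i = a then (n : ℝ) * ρ else 0) := by
    intro i
    simp only [Pi.add_apply, Pi.smul_apply, axisZ, smul_eq_mul, mul_ite, mul_one, mul_zero, Int.cast_add, Int.cast_ite,
      Int.cast_zero, add_mul, ite_mul, zero_mul]
  simp_rw [h, add_smul, Finset.sum_add_distrib, ite_smul, zero_smul, Finset.sum_ite_eq', Finset.mem_univ, if_true]
  abel

/-- The vertex `(a, b)` of the octahedron of the hole `w` is the frame vertex of the frame octahedron centred at `cubicPt w`. [formal bookkeeping] -/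
theorem lm_cubicPt_holeVertex (c₀ : E3) (f : Fin 3 → E3) (ρ : ℝ) (w : Fin 3 → ℤ) (u : Fin 3 × Bool) :
    cubicPt c₀ f ρ (holeVertex w u) = octVertex (cubicPt c₀ f ρ w) f ρ u.1 u.2 := by
  unfold holeVertex octVertex poleSign
  rw [lm_cubicPt_add_zsmul]
  cases u.2 <;> simp

/-- The axis neighbours `w ± e_a` of `w` are the frame vertices `(a, true)` / `(a, false)`. [formal bookkeeping] -/
theorem lm_cubicPt_add_axisZ (c₀ : E3) (f : Fin 3 → E3) (ρ : ℝ) (w : Fin 3 → ℤ) (a : Fin 3) :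
    cubicPt c₀ f ρ (w + axisZ a) = cubicPt c₀ f ρ w + ρ • f a := by
  have h := lm_cubicPt_add_zsmul c₀ f ρ w 1 a
  rwa [one_smul, Int.cast_one, one_mul] at h

/-- [formal bookkeeping] -/
theorem lm_cubicPt_sub_axisZ (c₀ : E3) (f : Fin 3 → E3) (ρ : ℝ) (w : Fin 3 → ℤ) (a : Fin 3) :
    cubicPt c₀ f ρ (w - axisZ a) = cubicPt c₀ f ρ w - ρ • f a := by
  have h := lm_cubicPt_add_zsmul c₀ f ρ w (-1) a
  rw [neg_smul, one_smul, ← sub_eq_add_neg, Int.cast_neg, Int.cast_one, neg_one_mul, neg_smul, ← sub_eq_add_neg] at h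
  exact h

/-- The lattice map of a cubic frame is injective (`f` orthonormal, `ρ ≠ 0`). [formal bookkeeping] -/
theorem lm_cubicPt_injective {c₀ : E3} {f : Fin 3 → E3} {ρ : ℝ} (hf : Orthonormal ℝ f) (hρ : ρ ≠ 0) :
    Function.Injective (cubicPt c₀ f ρ) := by
  intro w₁ w₂ h
  unfold cubicPt at h
  have h' : ∑ i, ((w₁ i : ℝ) * ρ) • f i = ∑ i, ((w₂ i : ℝ) * ρ) • f i := add_left_cancel h
  funext j
  have h1 := hf.inner_right_fintype (fun i => (w₁ i : ℝ) * ρ) j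
  have h2 := hf.inner_right_fintype (fun i => (w₂ i : ℝ) * ρ) j
  rw [h'] at h1
  rw [h1] at h2
  exact_mod_cast mul_right_cancel₀ hρ h2

/-- The centre of an axis-antipodal pair of poles is the frame centre. [formal bookkeeping] -/
theorem lm_octCentre_poles (c : E3) (f : Fin 3 → E3) (ρ : ℝ) (a : Fin 3) (b : Bool) :
    octCentre (octVertex c f ρ a (!b)) (octVertex c f ρ a b) = c := by
  unfold octCentre octVertex
  cases b <;> simp <;> module

/-- `y + z − v` is the antipode of the vertex `v` for an axis-antipodal pair of poles `(y, z)`. [formal bookkeeping] -/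
theorem lm_antipode_poles (c : E3) (f : Fin 3 → E3) (ρ : ℝ) (a : Fin 3) (b : Bool) (i : Fin 3) (b' : Bool) :
    octVertex c f ρ a (!b) + octVertex c f ρ a b - octVertex c f ρ i b' = octVertex c f ρ i (!b') := by
  unfold octVertex
  cases b <;> cases b' <;> simp <;> module

/-- An axis-antipodal pair of poles is at distance `2ρ`. [formal bookkeeping] -/
theorem lm_dist_poles {f : Fin 3 → E3} (hf : Orthonormal ℝ f) {ρ : ℝ} (hρ : 0 < ρ) (c : E3) (a : Fin 3) (b : Bool) :
    dist (octVertex c f ρ a (!b)) (octVertex c f ρ a b) = 2 * ρ := by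
  have hn : ‖f a‖ = 1 := hf.1 a
  cases b
  · simp only [octVertex, Bool.not_false, if_true, Bool.false_eq_true, if_false, dist_eq_norm]
    have : c + ρ • f a - (c + -ρ • f a) = (2 * ρ) • f a := by module
    rw [this, norm_smul, hn, mul_one, Real.norm_eq_abs, abs_of_pos (by positivity)]
  · simp only [octVertex, Bool.not_true, if_true, Bool.false_eq_true, if_false, dist_eq_norm]
    have : c + -ρ • f a - (c + ρ • f a) = (-(2 * ρ)) • f a := by module
    rw [this, norm_smul, hn, mul_one, Real.norm_eq_abs, abs_neg, abs_of_pos (by positivity)]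

/-- A pole is at distance `ρ` from the centre. [formal bookkeeping] -/
theorem lm_dist_pole_centre {f : Fin 3 → E3} (hf : Orthonormal ℝ f) {ρ : ℝ} (hρ : 0 ≤ ρ) (c : E3) (a : Fin 3) (b : Bool) :
    dist (octVertex c f ρ a b) c = ρ := by
  have hn : ‖f a‖ = 1 := hf.1 a
  cases b
  · simp only [octVertex, Bool.false_eq_true, if_false, dist_eq_norm, add_sub_cancel_left, norm_smul, norm_neg, hn, mul_one,
      Real.norm_eq_abs, abs_of_nonneg hρ]
  · simp only [octVertex, if_true, dist_eq_norm, add_sub_cancel_left, norm_smul, hn, mul_one, Real.norm_eq_abs, abs_of_nonneg hρ]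

/-- ★★ **DICTIONARY (a), PROVED**: the frame-free min-depth of a lattice octahedron is the hole min-depth of the lattice depth function. -/
theorem lm_octMinDepth_eq {P : PeriodicConfiguration 3} {r₁ : ℝ} {c₀ : E3} {f : Fin 3 → E3} {ρ : ℝ} {w : Fin 3 → ℤ} {y z : E3} (C : Set E3)
    (hO : ∀ x, InOct P r₁ y z x ↔ ∃ i b', x = octVertex (cubicPt c₀ f ρ w) f ρ i b') :
    octMinDepth C P r₁ y z = hDepthMin (latDepth C c₀ f ρ) w := by
  rw [octMinDepth_eq_setMinDepth C hO]
  unfold setMinDepth hDepthMin setDepth latDepth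
  congr 1
  funext u
  rw [lm_cubicPt_holeVertex]

/-- ★★ **DICTIONARY (b), PROVED**: the frame-free max-kink of a lattice octahedron of an axis-antipodal mid pair is the hole max-kink of the lattice
depth function. -/
theorem lm_octMaxKink_eq {P : PeriodicConfiguration 3} {r₁ : ℝ} {c₀ : E3} {f : Fin 3 → E3} {ρ : ℝ} {w : Fin 3 → ℤ} {a : Fin 3} {b : Bool}
    {y z : E3} (C : Set E3) (hf : Orthonormal ℝ f) (hρ : 0 < ρ)
    (hy : y = octVertex (cubicPt c₀ f ρ w) f ρ a (!b)) (hz : z = octVertex (cubicPt c₀ f ρ w) f ρ a b)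
    (hO : ∀ x, InOct P r₁ y z x ↔ ∃ i b', x = octVertex (cubicPt c₀ f ρ w) f ρ i b') :
    octMaxKink C P r₁ y z = hMaxKink ρ (latDepth C c₀ f ρ) w := by
  unfold octMaxKink
  have hfun : (octKink C y z ∘ fun u : Fin 3 × Bool => octVertex (cubicPt c₀ f ρ w) f ρ u.1 u.2) =
      fun u : Fin 3 × Bool => hKink ρ (latDepth C c₀ f ρ) w u.1 := by
    funext u
    simp only [Function.comp]
    unfold octKink hKink latDepth
    rw [hy, hz, lm_octCentre_poles, lm_antipode_poles, lm_dist_poles hf hρ, mul_div_cancel_left₀ _ (two_ne_zero),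
      lm_cubicPt_add_axisZ, lm_cubicPt_sub_axisZ]
    rcases u with ⟨i, b'⟩
    cases b'
    · simp only [octVertex, Bool.not_false, if_true, Bool.false_eq_true, if_false, neg_smul, ← sub_eq_add_neg]
      ring
    · simp only [octVertex, Bool.not_true, if_true, Bool.false_eq_true, if_false, neg_smul, ← sub_eq_add_neg]
  rw [fz_inOct_eq_range hO, ← Set.range_comp, hfun, ← Set.image_univ, ← Finset.coe_univ, ← Finset.sup'_eq_csSup_image _ Finset.univ_nonempty]
  unfold hMaxKink
  refine le_antisymm (Finset.sup'_le _ _ fun u _ => Finset.le_sup' _ (Finset.mem_univ u.1)) ?_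
  exact Finset.sup'_le _ _ fun i _ => Finset.le_sup' (f := fun u : Fin 3 × Bool => hKink ρ (latDepth C c₀ f ρ) w u.1) (Finset.mem_univ (i, true))

/-- ★★ **DICTIONARY (c), PROVED**: the cap value of a lattice octahedron of an axis-antipodal mid pair is `unit · capK(hole min-depth, hole max-kink)`. -/
theorem lm_capVal_eq {P : PeriodicConfiguration 3} {r₁ : ℝ} {c₀ : E3} {f : Fin 3 → E3} {ρ : ℝ} {w : Fin 3 → ℤ} {a : Fin 3} {b : Bool}
    {y z : E3} (unit : ℝ) (C : Set E3) (hf : Orthonormal ℝ f) (hρ : 0 < ρ)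
    (hy : y = octVertex (cubicPt c₀ f ρ w) f ρ a (!b)) (hz : z = octVertex (cubicPt c₀ f ρ w) f ρ a b)
    (hO : ∀ x, InOct P r₁ y z x ↔ ∃ i b', x = octVertex (cubicPt c₀ f ρ w) f ρ i b') :
    capVal unit C P r₁ y z = unit * capK (hDepthMin (latDepth C c₀ f ρ) w) (hMaxKink ρ (latDepth C c₀ f ρ) w) := by
  unfold capVal
  rw [lm_octMinDepth_eq C hO, lm_octMaxKink_eq C hf hρ hy hz hO]

end FrameLemmas

/-! ## §L6 The two line constraints of the lattice depth function (PROVED: `1`-Lipschitz and the discrete semiconcavity of NODE 81) -/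

section LineConstraints

/-- The lattice depth is non-negative. [formal bookkeeping] -/
theorem lm_latDepth_nonneg (C : Set E3) (c₀ : E3) (f : Fin 3 → E3) (ρ : ℝ) (w : Fin 3 → ℤ) : 0 ≤ latDepth C c₀ f ρ w :=
  Metric.infDist_nonneg

/-- ★ Along an axis the lattice depth is `ρ`-Lipschitz per step. -/
theorem lm_latDepth_lipschitz (C : Set E3) (c₀ : E3) {f : Fin 3 → E3} (hf : Orthonormal ℝ f) {ρ : ℝ} (hρ : 0 ≤ ρ) (w : Fin 3 → ℤ) (a : Fin 3) :
    |latDepth C c₀ f ρ (w + axisZ a) - latDepth C c₀ f ρ w| ≤ ρ := by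
  unfold latDepth
  have hd : dist (cubicPt c₀ f ρ (w + axisZ a)) (cubicPt c₀ f ρ w) = ρ := by
    rw [lm_cubicPt_add_axisZ, dist_eq_norm, add_sub_cancel_left, norm_smul, hf.1 a, mul_one, Real.norm_eq_abs, abs_of_nonneg hρ]
  rw [abs_sub_le_iff]
  constructor
  · have := Metric.infDist_le_infDist_add_dist (s := C) (x := cubicPt c₀ f ρ (w + axisZ a)) (y := cubicPt c₀ f ρ w)
    linarith
  · have := Metric.infDist_le_infDist_add_dist (s := C) (x := cubicPt c₀ f ρ w) (y := cubicPt c₀ f ρ (w + axisZ a))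
    rw [dist_comm] at this
    linarith

/-- ★ Along an axis the lattice depth obeys the discrete semiconcavity `d(w + e_a)² + d(w − e_a)² ≤ 2 d(w)² + 2ρ²` (tree `infDist_sq_secondDiff_le`;
trivially for `C = ∅`). -/
theorem lm_latDepth_secondDiff (C : Set E3) (c₀ : E3) {f : Fin 3 → E3} (hf : Orthonormal ℝ f) (ρ : ℝ) (w : Fin 3 → ℤ) (a : Fin 3) :
    latDepth C c₀ f ρ (w + axisZ a) ^ 2 + latDepth C c₀ f ρ (w - axisZ a) ^ 2 ≤ 2 * latDepth C c₀ f ρ w ^ 2 + 2 * ρ ^ 2 := by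
  unfold latDepth
  rcases C.eq_empty_or_nonempty with hC | hC
  · simp [hC]; positivity
  · rw [lm_cubicPt_add_axisZ, lm_cubicPt_sub_axisZ]
    exact infDist_sq_secondDiff_le hC _ _ (hf.1 a) ρ

end LineConstraints

end Summit.AtomisticToContinuum.Crystallization.Theorems.ChargedEnergyGapChartDial
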